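import Literature.AnabelianGeometry.SemiGraphs.TemperedCompactInVerticialOfFixedSystems
import Literature.AnabelianGeometry.SemiGraphs.TemperedPiVerticialLevelData
import Literature.AnabelianGeometry.SemiGraphs.TemperedChartTransport
import Literature.AnabelianGeometry.SemiGraphs.TemperedVerticialNamedFactsProofs
import Literature.AnabelianGeometry.SemiGraphs.TemperedReconstructionCor39UpToTwistAssemblyAt
import HarnessLib

/-!
# [SemiAnbd] Thm 3.7 (iii) AT ONE GRAPH and Cor. 3.9 at one pair FROM THE FIXED-SYSTEMS INPUT (FIX∞) at the
# CANONICAL tower — chart transport (GAP G-t6g3-2, bricks B2 + B3; proof-only)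

Mochizuki, *Semi-graphs of anabelioids*, Publ. RIMS **42** (2006), §3, Theorem 3.7 (iii), manuscript pp. 40–41
(«we may assume that there exists a compatible system of vertices of `𝒢_{∞,j}` … each of which is fixed by `H`»;
«if `H` fixes two vertices of `𝒢_{∞,j}`, then these two vertices are joined to one another by a single edge»),
Cor. 3.9 p. 42 [cite: MochizukiSemiAnbd2006, Thm 3.7(iii) pp.40-41].

PROOF-ONLY (cell abc-iut, layer L3; L3-lead ruling α27 (1) «G-t6g3-2 BEYOND FINITE 𝒢», bricks B2+B3, seat
abc-iut-w4-d083; plan of record = abc-iut-L3-t10 g4's SHAPES-Ggt6g32.md §(c)).  Brick B1 (abc-iut-w4-d080,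
`TemperedCompactInVerticialOfFixedSystems.lean`) proves the BODY of Thm 3.7 (iii) for a chart `c` and level data
`D : VerticialLevelData 𝒢 c` from the two HYPOTHESIS binders (FIX∞) = `hfix` (every compact `C ≠ 1` fixes a
compatible system of tree vertices) + `hadj` (two compatible `C`-fixed systems that differ at level `j` are joined
there by a `C`-fixed edge).  Here:
* `VerticialLevelData.hfix_transport` / `hadj_transport` — (FIX∞) TRANSPORTS along abc-iut-L3-t10's
  `VerticialLevelData.transport` (charts compatibly isomorphic, `TemperedPiChart.exists_compatIso`): the transported
  data keep the trees and transitions and act through `ψ : c.G → c₀.G`, so «`C`-fixed for `D₀.transport`» IS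
  «`ψ(C)`-fixed for `D₀`» (`ψ(C)` compact, non-trivial);
* **B2 `compactInVerticialAt_of_fixedSystems`**: (FIX∞) at the CANONICAL level data of abc-iut-L3-t8
  (`verticialLevelData_temperedPiChart h36`, the Galois tower of Prop. 3.6 acting on the trees `𝔾̃_n`) ⇒ the
  per-graph Thm 3.7 (iii) `CompactInVerticialAt 𝒢` for EVERY chart (B1 + transport + Thm 3.7 (i)(ii)
  `verticialInjective_holds` / `verticialDistinct_holds`);
* **B3 `cor39UpToTwistAt_of_fixedSystems`**: Cor. 3.9 (compatible reading, up to twist) at a pair from (FIX∞) at the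
  canonical towers of both graphs (abc-iut-w4-d080's `cor39UpToTwistAt`).
(FIX∞) stays a HYPOTHESIS (D-0067 (1); a THEOREM at finite `𝔾`, OPEN beyond print for infinite countable `𝔾` —
GAP G-t6g3-2b); no definition; nothing here asserts Thm 3.7 (iii) for an infinite `𝔾`; nothing here bears on
[IUTchIII] Cor. 3.12; typed ≠ proved.
-/

namespace Literature.AnabelianGeometry.SemiGraphs

namespace ProfiniteSemiGraph

open CategoryTheory Topology

universe v u

namespace VerticialLevelData

variable {𝒢 : ProfiniteSemiGraph.{u}} {c c' : TemperedPiChart 𝒢} (D : VerticialLevelData.{v} 𝒢 c)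
  (φ : c.G →ₜ* c'.G) (ψ : c'.G →ₜ* c.G) (hψφ : ∀ x, ψ (φ x) = x) (hφψ : ∀ y, φ (ψ y) = y)
  (hV : ∀ (v : 𝒢.graph.Vertex) (H : Subgroup c'.G),
    H ∈ verticialSubgroups c' v ↔ H.map ψ.toMonoidHom ∈ verticialSubgroups c v)
  (hE : ∀ (e : 𝒢.graph.Edge) (L : Subgroup c'.G),
    L ∈ edgeLikeSubgroups c' e ↔ L.map ψ.toMonoidHom ∈ edgeLikeSubgroups c e)

include hφψ in
/-- `ψ(C)` of a non-trivial compact `C` is non-trivial and compact. [cite: MochizukiSemiAnbd2006, Prop 3.6(ii) p.38] -/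
private theorem map_compact_ne_bot {C : Subgroup c'.G} (hC : IsCompact (C : Set c'.G)) (hne : C ≠ ⊥) :
    IsCompact ((C.map ψ.toMonoidHom : Subgroup c.G) : Set c.G) ∧ C.map ψ.toMonoidHom ≠ ⊥ := by
  have hinj : Function.Injective ψ := fun y₁ y₂ h => by rw [← hφψ y₁, ← hφψ y₂, h]
  refine ⟨?_, fun h0 => hne ((Subgroup.map_eq_bot_iff_of_injective C hinj).mp h0)⟩
  rw [Subgroup.coe_map]
  exact hC.image ψ.continuous

/-- **(FIX∞), first clause, transports along a compatible isomorphism of charts**: the transported level data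
`D.transport φ ψ …` keep the trees and act through `ψ`, so the `ψ(C)`-fixed compatible vertex system of `D`
is a `C`-fixed compatible vertex system of the transport. [cite: MochizukiSemiAnbd2006, Thm 3.7(iii) p.41] -/
theorem hfix_transport
    (hfix : ∀ C : Subgroup c.G, IsCompact (C : Set c.G) → C ≠ ⊥ →
      ∃ x : ∀ j, (D.tree j).Vertex, (∀ ⦃i j : D.J⦄ (h : i ≤ j), (D.trans h).vertexMap (x j) = x i) ∧
        ∀ g ∈ C, ∀ j, (D.act j g).hom.vertexMap (x j) = x j) :
    ∀ C : Subgroup c'.G, IsCompact (C : Set c'.G) → C ≠ ⊥ →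
      ∃ x : ∀ j, ((D.transport φ ψ hψφ hφψ hV hE).tree j).Vertex,
        (∀ ⦃i j : (D.transport φ ψ hψφ hφψ hV hE).J⦄ (h : i ≤ j),
          ((D.transport φ ψ hψφ hφψ hV hE).trans h).vertexMap (x j) = x i) ∧
        ∀ g ∈ C, ∀ j, ((D.transport φ ψ hψφ hφψ hV hE).act j g).hom.vertexMap (x j) = x j := by
  intro C hC hne
  obtain ⟨hc, hne'⟩ := map_compact_ne_bot φ ψ hφψ hC hne
  obtain ⟨x, hxc, hxf⟩ := hfix (C.map ψ.toMonoidHom) hc hne'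
  exact ⟨x, hxc, fun g hg j => hxf (ψ g) ⟨g, hg, rfl⟩ j⟩

/-- **(FIX∞), second clause (adjacency of distinct fixed systems), transports likewise.**
[cite: MochizukiSemiAnbd2006, Thm 3.7(iii) p.41] -/
theorem hadj_transport
    (hadj : ∀ C : Subgroup c.G, IsCompact (C : Set c.G) → C ≠ ⊥ → ∀ x x' : ∀ j, (D.tree j).Vertex,
      (∀ ⦃i j : D.J⦄ (h : i ≤ j), (D.trans h).vertexMap (x j) = x i) →
      (∀ ⦃i j : D.J⦄ (h : i ≤ j), (D.trans h).vertexMap (x' j) = x' i) →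
      (∀ g ∈ C, ∀ j, (D.act j g).hom.vertexMap (x j) = x j) →
      (∀ g ∈ C, ∀ j, (D.act j g).hom.vertexMap (x' j) = x' j) →
      ∀ j, x j ≠ x' j → ∃ (e : (D.tree j).Edge) (b b' : (D.tree j).Branch), b ≠ b' ∧
        (D.tree j).edgeOf b = e ∧ (D.tree j).edgeOf b' = e ∧ (D.tree j).abuts b = some (x j) ∧
        (D.tree j).abuts b' = some (x' j) ∧ ∀ g ∈ C, (D.act j g).hom.edgeMap e = e) :
    ∀ C : Subgroup c'.G, IsCompact (C : Set c'.G) → C ≠ ⊥ →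
      ∀ x x' : ∀ j, ((D.transport φ ψ hψφ hφψ hV hE).tree j).Vertex,
      (∀ ⦃i j : (D.transport φ ψ hψφ hφψ hV hE).J⦄ (h : i ≤ j),
        ((D.transport φ ψ hψφ hφψ hV hE).trans h).vertexMap (x j) = x i) →
      (∀ ⦃i j : (D.transport φ ψ hψφ hφψ hV hE).J⦄ (h : i ≤ j),
        ((D.transport φ ψ hψφ hφψ hV hE).trans h).vertexMap (x' j) = x' i) →
      (∀ g ∈ C, ∀ j, ((D.transport φ ψ hψφ hφψ hV hE).act j g).hom.vertexMap (x j) = x j) →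
      (∀ g ∈ C, ∀ j, ((D.transport φ ψ hψφ hφψ hV hE).act j g).hom.vertexMap (x' j) = x' j) →
      ∀ j, x j ≠ x' j →
        ∃ (e : ((D.transport φ ψ hψφ hφψ hV hE).tree j).Edge)
          (b b' : ((D.transport φ ψ hψφ hφψ hV hE).tree j).Branch), b ≠ b' ∧
          ((D.transport φ ψ hψφ hφψ hV hE).tree j).edgeOf b = e ∧
          ((D.transport φ ψ hψφ hφψ hV hE).tree j).edgeOf b' = e ∧
          ((D.transport φ ψ hψφ hφψ hV hE).tree j).abuts b = some (x j) ∧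
          ((D.transport φ ψ hψφ hφψ hV hE).tree j).abuts b' = some (x' j) ∧
          ∀ g ∈ C, ((D.transport φ ψ hψφ hφψ hV hE).act j g).hom.edgeMap e = e := by
  intro C hC hne x x' hx hx' hfx hfx' j hj
  obtain ⟨hc, hne'⟩ := map_compact_ne_bot φ ψ hφψ hC hne
  have hfxψ : ∀ g ∈ C.map ψ.toMonoidHom, ∀ j, (D.act j g).hom.vertexMap (x j) = x j := by
    rintro _ ⟨g, hg, rfl⟩ j
    exact hfx g hg j
  have hfxψ' : ∀ g ∈ C.map ψ.toMonoidHom, ∀ j, (D.act j g).hom.vertexMap (x' j) = x' j := by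
    rintro _ ⟨g, hg, rfl⟩ j
    exact hfx' g hg j
  obtain ⟨e, b, b', hbb, hbe, hb'e, hb, hb', hef⟩ :=
    hadj (C.map ψ.toMonoidHom) hc hne' x x' hx hx' hfxψ hfxψ' j hj
  exact ⟨e, b, b', hbb, hbe, hb'e, hb, hb', fun g hg => hef (ψ g) ⟨g, hg, rfl⟩⟩

end VerticialLevelData

/-! ### B2: Thm 3.7 (iii) at the graph from (FIX∞) at the canonical tower -/

variable {𝒢 ℋ : ProfiniteSemiGraph.{u}}

/-- **B2 — Thm 3.7 (iii) AT `𝒢`, for EVERY chart, from (FIX∞) at the CANONICAL level data** (abc-iut-L3-t8's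
`verticialLevelData_temperedPiChart h36`: the trees `𝔾̃_n` of the Galois tower of Prop. 3.6 with the action of
`π₁^temp(𝒢)`): if every non-trivial compact subgroup of the canonical `π₁^temp(𝒢)` fixes a compatible system of
tree vertices (`Hfix`) and two compatible fixed systems that differ at a level are joined there by a fixed edge
(`Hadj`) — print p. 41 ll. 31–35 — then `CompactInVerticialAt 𝒢`.  Route: charts are compatibly isomorphic
(`TemperedPiChart.exists_compatIso`), the level data and (FIX∞) transport (`VerticialLevelData.transport`,
`hfix_transport`, `hadj_transport`), and brick B1 `VerticialLevelData.compactInVerticial_of_fixedSystems`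
(abc-iut-w4-d080) with Thm 3.7 (i)(ii) (`verticialInjective_holds`, `verticialDistinct_holds`).
[cite: MochizukiSemiAnbd2006, Thm 3.7(iii) pp.40-41] -/
theorem compactInVerticialAt_of_fixedSystems (h36 : 𝒢.Prop36Hypotheses)
    (Hfix : ∀ C : Subgroup (𝒢.temperedPiChart h36).G, IsCompact (C : Set (𝒢.temperedPiChart h36).G) →
      C ≠ ⊥ → ∃ x : ∀ j, ((verticialLevelData_temperedPiChart (h36 := h36)).tree j).Vertex,
        (∀ ⦃i j : (verticialLevelData_temperedPiChart (h36 := h36)).J⦄ (h : i ≤ j),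
          ((verticialLevelData_temperedPiChart (h36 := h36)).trans h).vertexMap (x j) = x i) ∧
        ∀ g ∈ C, ∀ j,
          ((verticialLevelData_temperedPiChart (h36 := h36)).act j g).hom.vertexMap (x j) = x j)
    (Hadj : ∀ C : Subgroup (𝒢.temperedPiChart h36).G, IsCompact (C : Set (𝒢.temperedPiChart h36).G) →
      C ≠ ⊥ → ∀ x x' : ∀ j, ((verticialLevelData_temperedPiChart (h36 := h36)).tree j).Vertex,
      (∀ ⦃i j : (verticialLevelData_temperedPiChart (h36 := h36)).J⦄ (h : i ≤ j),
        ((verticialLevelData_temperedPiChart (h36 := h36)).trans h).vertexMap (x j) = x i) →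
      (∀ ⦃i j : (verticialLevelData_temperedPiChart (h36 := h36)).J⦄ (h : i ≤ j),
        ((verticialLevelData_temperedPiChart (h36 := h36)).trans h).vertexMap (x' j) = x' i) →
      (∀ g ∈ C, ∀ j,
        ((verticialLevelData_temperedPiChart (h36 := h36)).act j g).hom.vertexMap (x j) = x j) →
      (∀ g ∈ C, ∀ j,
        ((verticialLevelData_temperedPiChart (h36 := h36)).act j g).hom.vertexMap (x' j) = x' j) →
      ∀ j, x j ≠ x' j →
        ∃ (e : ((verticialLevelData_temperedPiChart (h36 := h36)).tree j).Edge)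
          (b b' : ((verticialLevelData_temperedPiChart (h36 := h36)).tree j).Branch), b ≠ b' ∧
          ((verticialLevelData_temperedPiChart (h36 := h36)).tree j).edgeOf b = e ∧
          ((verticialLevelData_temperedPiChart (h36 := h36)).tree j).edgeOf b' = e ∧
          ((verticialLevelData_temperedPiChart (h36 := h36)).tree j).abuts b = some (x j) ∧
          ((verticialLevelData_temperedPiChart (h36 := h36)).tree j).abuts b' = some (x' j) ∧
          ∀ g ∈ C, ((verticialLevelData_temperedPiChart (h36 := h36)).act j g).hom.edgeMap e = e) :
    CompactInVerticialAt 𝒢 := by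
  intro h37 c C hC
  obtain ⟨φ, ψ, hψφ, hφψ, hφ, hψ⟩ := TemperedPiChart.exists_compatIso (𝒢.temperedPiChart h36) c
  let D₀ := verticialLevelData_temperedPiChart (h36 := h36)
  let D : VerticialLevelData.{0} 𝒢 c := D₀.transport φ ψ hψφ hφψ
    (fun v H => mem_verticialSubgroups_iff_map φ hφ ψ hφψ hψ H)
    (fun e L => mem_edgeLikeSubgroups_iff_map φ hφ ψ hφψ hψ L)
  exact D.compactInVerticial_of_fixedSystems verticialDistinct_holds h37
    (fun v => (verticialInjective_holds 𝒢 h37 c v).1)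
    (D₀.hfix_transport φ ψ hψφ hφψ _ _ Hfix) (D₀.hadj_transport φ ψ hψφ hφψ _ _ Hadj) C hC

/-! ### B3: Cor. 3.9 at a pair from (FIX∞) at the two canonical towers -/

/-- **B3 — [SemiAnbd] Cor. 3.9 (compatible reading, induced up to twist) AT THE PAIR `(𝒢, ℋ)` from (FIX∞) at the
canonical towers of `𝒢` and of `ℋ`** (abc-iut-w4-d080's `cor39UpToTwistAt` ∘ B2 twice): no finiteness binder —
the countable case modulo exactly (FIX∞). [cite: MochizukiSemiAnbd2006, Cor 3.9 pp.42-43] -/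
theorem cor39UpToTwistAt_of_fixedSystems (h36𝒢 : 𝒢.Prop36Hypotheses) (h36ℋ : ℋ.Prop36Hypotheses)
    (Hfix𝒢 : ∀ C : Subgroup (𝒢.temperedPiChart h36𝒢).G, IsCompact (C : Set (𝒢.temperedPiChart h36𝒢).G) →
      C ≠ ⊥ → ∃ x : ∀ j, ((verticialLevelData_temperedPiChart (h36 := h36𝒢)).tree j).Vertex,
        (∀ ⦃i j : (verticialLevelData_temperedPiChart (h36 := h36𝒢)).J⦄ (h : i ≤ j),
          ((verticialLevelData_temperedPiChart (h36 := h36𝒢)).trans h).vertexMap (x j) = x i) ∧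
        ∀ g ∈ C, ∀ j,
          ((verticialLevelData_temperedPiChart (h36 := h36𝒢)).act j g).hom.vertexMap (x j) = x j)
    (Hadj𝒢 : ∀ C : Subgroup (𝒢.temperedPiChart h36𝒢).G, IsCompact (C : Set (𝒢.temperedPiChart h36𝒢).G) →
      C ≠ ⊥ → ∀ x x' : ∀ j, ((verticialLevelData_temperedPiChart (h36 := h36𝒢)).tree j).Vertex,
      (∀ ⦃i j : (verticialLevelData_temperedPiChart (h36 := h36𝒢)).J⦄ (h : i ≤ j),
        ((verticialLevelData_temperedPiChart (h36 := h36𝒢)).trans h).vertexMap (x j) = x i) →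
      (∀ ⦃i j : (verticialLevelData_temperedPiChart (h36 := h36𝒢)).J⦄ (h : i ≤ j),
        ((verticialLevelData_temperedPiChart (h36 := h36𝒢)).trans h).vertexMap (x' j) = x' i) →
      (∀ g ∈ C, ∀ j,
        ((verticialLevelData_temperedPiChart (h36 := h36𝒢)).act j g).hom.vertexMap (x j) = x j) →
      (∀ g ∈ C, ∀ j,
        ((verticialLevelData_temperedPiChart (h36 := h36𝒢)).act j g).hom.vertexMap (x' j) = x' j) →
      ∀ j, x j ≠ x' j →
        ∃ (e : ((verticialLevelData_temperedPiChart (h36 := h36𝒢)).tree j).Edge)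
          (b b' : ((verticialLevelData_temperedPiChart (h36 := h36𝒢)).tree j).Branch), b ≠ b' ∧
          ((verticialLevelData_temperedPiChart (h36 := h36𝒢)).tree j).edgeOf b = e ∧
          ((verticialLevelData_temperedPiChart (h36 := h36𝒢)).tree j).edgeOf b' = e ∧
          ((verticialLevelData_temperedPiChart (h36 := h36𝒢)).tree j).abuts b = some (x j) ∧
          ((verticialLevelData_temperedPiChart (h36 := h36𝒢)).tree j).abuts b' = some (x' j) ∧
          ∀ g ∈ C, ((verticialLevelData_temperedPiChart (h36 := h36𝒢)).act j g).hom.edgeMap e = e)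
    (Hfixℋ : ∀ C : Subgroup (ℋ.temperedPiChart h36ℋ).G, IsCompact (C : Set (ℋ.temperedPiChart h36ℋ).G) →
      C ≠ ⊥ → ∃ x : ∀ j, ((verticialLevelData_temperedPiChart (h36 := h36ℋ)).tree j).Vertex,
        (∀ ⦃i j : (verticialLevelData_temperedPiChart (h36 := h36ℋ)).J⦄ (h : i ≤ j),
          ((verticialLevelData_temperedPiChart (h36 := h36ℋ)).trans h).vertexMap (x j) = x i) ∧
        ∀ g ∈ C, ∀ j,
          ((verticialLevelData_temperedPiChart (h36 := h36ℋ)).act j g).hom.vertexMap (x j) = x j)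
    (Hadjℋ : ∀ C : Subgroup (ℋ.temperedPiChart h36ℋ).G, IsCompact (C : Set (ℋ.temperedPiChart h36ℋ).G) →
      C ≠ ⊥ → ∀ x x' : ∀ j, ((verticialLevelData_temperedPiChart (h36 := h36ℋ)).tree j).Vertex,
      (∀ ⦃i j : (verticialLevelData_temperedPiChart (h36 := h36ℋ)).J⦄ (h : i ≤ j),
        ((verticialLevelData_temperedPiChart (h36 := h36ℋ)).trans h).vertexMap (x j) = x i) →
      (∀ ⦃i j : (verticialLevelData_temperedPiChart (h36 := h36ℋ)).J⦄ (h : i ≤ j),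
        ((verticialLevelData_temperedPiChart (h36 := h36ℋ)).trans h).vertexMap (x' j) = x' i) →
      (∀ g ∈ C, ∀ j,
        ((verticialLevelData_temperedPiChart (h36 := h36ℋ)).act j g).hom.vertexMap (x j) = x j) →
      (∀ g ∈ C, ∀ j,
        ((verticialLevelData_temperedPiChart (h36 := h36ℋ)).act j g).hom.vertexMap (x' j) = x' j) →
      ∀ j, x j ≠ x' j →
        ∃ (e : ((verticialLevelData_temperedPiChart (h36 := h36ℋ)).tree j).Edge)
          (b b' : ((verticialLevelData_temperedPiChart (h36 := h36ℋ)).tree j).Branch), b ≠ b' ∧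
          ((verticialLevelData_temperedPiChart (h36 := h36ℋ)).tree j).edgeOf b = e ∧
          ((verticialLevelData_temperedPiChart (h36 := h36ℋ)).tree j).edgeOf b' = e ∧
          ((verticialLevelData_temperedPiChart (h36 := h36ℋ)).tree j).abuts b = some (x j) ∧
          ((verticialLevelData_temperedPiChart (h36 := h36ℋ)).tree j).abuts b' = some (x' j) ∧
          ∀ g ∈ C, ((verticialLevelData_temperedPiChart (h36 := h36ℋ)).act j g).hom.edgeMap e = e)
    (h𝒢 : Cor39Hypotheses 𝒢) (hℋ : Cor39Hypotheses ℋ) (c𝒢 : TemperedPiChart 𝒢) (cℋ : TemperedPiChart ℋ) :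
    (∀ (F : Hom 𝒢 ℋ), F.IsLocallyOpen → ∀ φ : c𝒢.G →ₜ* cℋ.G,
        (∃ θ : F.ConjugatorFamily, Nonempty (F.chartPullbackWith θ c𝒢 cℋ ≅ BTemp.res φ)) →
          IsCompatiblyQuasiGeometric φ) ∧
      ∀ φ : c𝒢.G →ₜ* cℋ.G, IsCompatiblyQuasiGeometric φ →
        ∃ F : Hom 𝒢 ℋ, F.IsLocallyOpen ∧
          (∃ θ : F.ConjugatorFamily, Nonempty (F.chartPullbackWith θ c𝒢 cℋ ≅ BTemp.res φ)) ∧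
          ∀ F' : Hom 𝒢 ℋ, F'.IsLocallyOpen →
            (∃ θ' : F'.ConjugatorFamily, Nonempty (F'.chartPullbackWith θ' c𝒢 cℋ ≅ BTemp.res φ)) →
              F'.base.vertexMap = F.base.vertexMap ∧ F'.base.edgeMap = F.base.edgeMap :=
  cor39UpToTwistAt (compactInVerticialAt_of_fixedSystems h36𝒢 Hfix𝒢 Hadj𝒢)
    (compactInVerticialAt_of_fixedSystems h36ℋ Hfixℋ Hadjℋ) h𝒢 hℋ c𝒢 cℋ

end ProfiniteSemiGraph

end Literature.AnabelianGeometry.SemiGraphs
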